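import Literature.NumberTheory.Sieve.TypeTwoBlock
import Literature.NumberTheory.Sieve.SmoothCubeWeights
import Literature.NumberTheory.Sieve.ResidueClassBoxCount
import HarnessLib

/-!
# From smooth cube weights to the sharp cube: the sandwich and the boundary layer

Topic `Literature/NumberTheory/Sieve`, sub-namespace `SmoothToSharp`. The smooth weight
`Ω(α) = ∏_w κ_{a,ε}(log σ_wα − log M)` (`κ_{a,ε}` the profile of `SmoothCubeWeights`: values in
`[0,1]`, `= 1` on `[a, −ε]`, `= 0` off `(a − log 2, 0)`) satisfies, on the cube `A₀(M)`,
`Ω ≤ 1_{A₀(M)}` and `1_{A₀(M)} − Ω ≤ 1_{Layer}`, `Layer = A₀(M) ∖ (e^a M, e^{−ε} M]^d`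
(`sum_le_card`, `card_sub_sum_le`). The layer is thin: in every coset of every ideal `𝔮`,

`#(Layer ∩ (α₀ + 𝔮)) ≤ d M^d (ε + e^a)/(N𝔮 √|D|) + 2 C_G (1 + (M^d/N𝔮)^{1−1/d})`

(`card_layer_coset_le`, from the uniform residue-class box count
`CastilloEtAl2015.abs_card_cbox_coset_sub_le_uniform` applied to the two boxes), and the boundary
terms summed over `N𝔮 ≤ Q` are `≤ M^{d−1} Q^{1/d} H(Q)` (`sum_rpow_quot_le`). This is the smooth
replacement for the sharp truncations in Hinz 1988, §2, and feeds the final assembly of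
`MaynardNF.PrimesHaveLevel` from the smooth estimates.

## References

* J. Hinz, Acta Arith. 51 (1988), §1 (1.4)–(1.5), §2. [cite: Hinz1988, §1 (1.4)–(1.5)]
* A. Castillo, C. Hall, R. J. Lemke Oliver, P. Pollack, L. Thompson, Proc. AMS 143 (2015), §2.1
  (the boxes `A₀(N)`). [cite: CastilloEtAl2015, §2.1 (definition of A₀(N))]
-/

noncomputable section

open Finset NumberField NumberField.InfinitePlace
  Literature.NumberTheory.Sieve.NumberFieldLS Literature.NumberTheory.LFunctions
  Literature.NumberTheory.LFunctions.NumberField Literature.NumberTheory.Sieve.CastilloEtAl2015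
  Literature.NumberTheory.Sieve.MitsuiPNT Literature.NumberTheory.Sieve.TypeTwoReparam
  Literature.NumberTheory.Sieve.TypeTwoBlock Literature.NumberTheory.Sieve.TypeTwoCoeff
  Literature.NumberTheory.Sieve.SmoothWeights
open scoped Classical nonZeroDivisors

namespace Literature.NumberTheory.Sieve.SmoothToSharp

variable {K : Type*} [Field K] [NumberField K] [IsTotallyReal K]

local notation "d" => Module.finrank ℚ K
local notation "RP" => {w : InfinitePlace K // IsReal w}

/-! ## The real weight -/

variable (K) in
/-- `Ω_{a,ε}(α) = ∏_w κ_{a,ε}(log σ_wα − log M)`. [folklore] -/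
def ΩR (a ε M : ℝ) (α : 𝓞 K) : ℝ := ∏ w : RP, kappa a ε (Real.log (remb K (α : K) w) - Real.log M)

omit [IsTotallyReal K] in
/-- The complex weight of `TypeTwoReparam` with profile `κ` is `Ω_{a,ε}`. [folklore] -/
theorem weightΩ_kappa (a ε M : ℝ) (α : 𝓞 K) :
    weightΩ K (fun v => (kappa a ε v : ℂ)) M α = (ΩR K a ε M α : ℂ) := by
  unfold weightΩ ΩR; rw [Complex.ofReal_prod]

omit [IsTotallyReal K] in
/-- `0 ≤ Ω ≤ 1`. [folklore] -/
theorem ΩR_nonneg (a ε M : ℝ) (α : 𝓞 K) : 0 ≤ ΩR K a ε M α :=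
  Finset.prod_nonneg fun _ _ => kappa_nonneg _ _ _

omit [IsTotallyReal K] in
/-- `Ω ≤ 1`. [folklore] -/
theorem ΩR_le_one (a ε M : ℝ) (α : 𝓞 K) : ΩR K a ε M α ≤ 1 :=
  Finset.prod_le_one (fun _ _ => kappa_nonneg _ _ _) fun _ _ => kappa_le_one _ _ _

/-! ## The inner box and the layer -/

variable (K) in
/-- The inner box `(e^a M, e^{−ε} M]^d` as a `Finset`. [folklore] -/
def innerF (a ε M : ℝ) : Finset (𝓞 K) :=
  (finite_cbox (K := K) (fun _ => Real.exp a * M) (fun _ => Real.exp (-ε) * M)).toFinset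

/-- Membership in `innerF`. [folklore] -/
theorem mem_innerF {a ε M : ℝ} {α : 𝓞 K} :
    α ∈ innerF K a ε M ↔ ∀ w : RP, Real.exp a * M < remb K (α : K) w ∧ remb K (α : K) w ≤ Real.exp (-ε) * M := by
  rw [innerF, Set.Finite.mem_toFinset, mem_cbox_iff_realEmb]
  simp only [Set.mem_Ioc, realEmb_eq_remb]

/-- The inner box lies in the cube (`ε ≥ 0`, `M ≥ 0`). [folklore] -/
theorem innerF_subset_cubeF {a ε M : ℝ} (hε : 0 ≤ ε) (hM : 0 ≤ M) : innerF K a ε M ⊆ cubeF K M := by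
  intro α hα
  rw [mem_cubeF, mem_box₀_iff_remb]
  intro w
  obtain ⟨h1, h2⟩ := (mem_innerF.1 hα) w
  refine ⟨lt_of_le_of_lt (by positivity) h1, h2.trans ?_⟩
  have : Real.exp (-ε) ≤ 1 := Real.exp_le_one_iff.2 (by linarith)
  nlinarith

/-- `Ω = 1` on the inner box (`0 < ε`, `0 < M`). [folklore] -/
theorem ΩR_eq_one_of_mem_innerF {a ε M : ℝ} (hε : 0 < ε) (hM : 0 < M) {α : 𝓞 K} (hα : α ∈ innerF K a ε M) :
    ΩR K a ε M α = 1 := by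
  unfold ΩR
  refine Finset.prod_eq_one fun w _ => ?_
  obtain ⟨h1, h2⟩ := (mem_innerF.1 hα) w
  have hpos : 0 < remb K (α : K) w := lt_of_le_of_lt (by positivity) h1
  refine kappa_eq_one hε ?_ ?_
  · have := Real.log_lt_log (by positivity) h1
    rw [Real.log_mul (Real.exp_pos a).ne' hM.ne', Real.log_exp] at this
    linarith
  · have := Real.log_le_log hpos h2
    rw [Real.log_mul (Real.exp_pos _).ne' hM.ne', Real.log_exp] at this
    linarith

/-! ## The sandwich -/

omit [IsTotallyReal K] in
/-- `∑_{α ∈ A₀(M), P} Ω(α) ≤ #{α ∈ A₀(M) : P}`. [folklore] -/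
theorem sum_le_card (a ε M : ℝ) (P : 𝓞 K → Prop) :
    ∑ α ∈ (cubeF K M).filter P, ΩR K a ε M α ≤ ((cubeF K M).filter P).card := by
  rw [Finset.card_eq_sum_ones, Nat.cast_sum]
  exact Finset.sum_le_sum fun α _ => by rw [Nat.cast_one]; exact ΩR_le_one a ε M α

/-- **`#{α ∈ A₀(M) : P} − ∑_{α ∈ A₀(M), P} Ω(α) ≤ #{α ∈ Layer : P}`** (`0 < ε`, `0 < M`). [folklore] -/
theorem card_sub_sum_le {a ε M : ℝ} (hε : 0 < ε) (hM : 0 < M) (P : 𝓞 K → Prop) :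
    (((cubeF K M).filter P).card : ℝ) - ∑ α ∈ (cubeF K M).filter P, ΩR K a ε M α ≤
      ((cubeF K M \ innerF K a ε M).filter P).card := by
  rw [Finset.card_eq_sum_ones, Nat.cast_sum, ← Finset.sum_sub_distrib, Finset.card_eq_sum_ones, Nat.cast_sum]
  have hsplit : (cubeF K M).filter P = ((cubeF K M \ innerF K a ε M).filter P) ∪ ((cubeF K M ∩ innerF K a ε M).filter P) := by
    rw [← Finset.filter_union, Finset.sdiff_union_inter]
  have hdisj : Disjoint ((cubeF K M \ innerF K a ε M).filter P) ((cubeF K M ∩ innerF K a ε M).filter P) :=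
    Finset.disjoint_filter_filter (Finset.disjoint_sdiff_inter _ _)
  rw [hsplit, Finset.sum_union hdisj]
  have h2 : ∑ α ∈ (cubeF K M ∩ innerF K a ε M).filter P, ((1 : ℕ) - ΩR K a ε M α : ℝ) = 0 := by
    refine Finset.sum_eq_zero fun α hα => ?_
    have hin := (Finset.mem_inter.1 (Finset.mem_filter.1 hα).1).2
    rw [ΩR_eq_one_of_mem_innerF hε hM hin]; simp
  rw [h2, add_zero]
  exact Finset.sum_le_sum fun α _ => by have := ΩR_nonneg (K := K) a ε M α; push_cast; linarith

/-! ## The layer in a residue class -/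

omit [NumberField K] [IsTotallyReal K] in
/-- Counting a subset of a `Finset` through `Nat.card` of a subtype. [folklore] -/
theorem card_filter_eq_natCard {S : Set (𝓞 K)} (hS : S.Finite) (P : 𝓞 K → Prop) :
    (hS.toFinset.filter P).card = Nat.card {α : 𝓞 K // α ∈ S ∧ P α} := by
  have hfin : ({α : 𝓞 K | α ∈ S ∧ P α} : Set (𝓞 K)).Finite := hS.subset fun α h => h.1
  rw [show Nat.card {α : 𝓞 K // α ∈ S ∧ P α} = hfin.toFinset.card from Nat.card_eq_card_finite_toFinset hfin]
  congr 1
  ext α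
  simp [Set.Finite.mem_toFinset]

/-- **The layer is thin in every residue class**: for `𝔮 ≠ 0`, `M ≥ 1`, `0 < ε`, `a ≤ −ε` and any
`α₀`, `#{α ∈ A₀(M) ∖ (e^aM, e^{−ε}M]^d : α ≡ α₀ mod 𝔮} ≤ d M^d (ε + e^a)/(N𝔮√|D|) + 2C_G(1 + (M^d/N𝔮)^{1−1/d})`,
`C_G` the constant of `abs_card_cbox_coset_sub_le_uniform`. [cite: Hinz1988, §1 (1.4)–(1.5)] -/
theorem card_layer_coset_le {CG : ℝ}
    (hCG : ∀ (𝔮 : (Ideal (𝓞 K))⁰) (N : ℝ), 1 ≤ N → ∀ (lo hi : RP → ℝ), (∀ w, lo w ≤ hi w) →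
      (∀ w, hi w - lo w ≤ N) → ∀ α₀ : 𝓞 K,
      |(Nat.card {α : 𝓞 K // α ∈ cbox K lo hi ∧ α - α₀ ∈ (𝔮 : Ideal (𝓞 K))} : ℝ) -
          (∏ w, (hi w - lo w)) / (Ideal.absNorm (𝔮 : Ideal (𝓞 K)) * √|discr K|)| ≤
        CG * (1 + (N ^ d / Ideal.absNorm (𝔮 : Ideal (𝓞 K))) ^ (1 - 1 / (d : ℝ))))
    {𝔮 : Ideal (𝓞 K)} (h𝔮 : 𝔮 ≠ ⊥) {M : ℝ} (hM : 1 ≤ M) {a ε : ℝ} (hε : 0 < ε) (haε : a ≤ -ε) (α₀ : 𝓞 K) :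
    (((cubeF K M \ innerF K a ε M).filter (fun α => α - α₀ ∈ 𝔮)).card : ℝ) ≤
      d * M ^ d * (ε + Real.exp a) / (Ideal.absNorm 𝔮 * √|discr K|) +
        2 * CG * (1 + (M ^ d / Ideal.absNorm 𝔮) ^ (1 - 1 / (d : ℝ))) := by
  have hM0 : 0 < M := by linarith
  set 𝔮' : (Ideal (𝓞 K))⁰ := ⟨𝔮, mem_nonZeroDivisors_of_ne_zero h𝔮⟩ with h𝔮'
  have hq : ((𝔮' : (Ideal (𝓞 K))⁰) : Ideal (𝓞 K)) = 𝔮 := rfl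
  -- the two box counts
  have hcube := hCG 𝔮' M hM (fun _ => 0) (fun _ => M) (fun _ => hM0.le) (fun _ => by simp) α₀
  have hlohi : ∀ _w : RP, Real.exp a * M ≤ Real.exp (-ε) * M := fun _ =>
    mul_le_mul_of_nonneg_right (Real.exp_le_exp.2 haε) hM0.le
  have hside : ∀ _w : RP, Real.exp (-ε) * M - Real.exp a * M ≤ M := fun _ => by
    have h1 : Real.exp (-ε) ≤ 1 := Real.exp_le_one_iff.2 (by linarith)
    have h2 : 0 ≤ Real.exp a := (Real.exp_pos a).le
    nlinarith
  have hinner := hCG 𝔮' M hM (fun _ => Real.exp a * M) (fun _ => Real.exp (-ε) * M) hlohi hside α₀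
  rw [hq] at hcube hinner
  -- identify the `Nat.card`s with `Finset` cardinalities
  have hcubeF : cubeF K M = (finite_cbox (K := K) (fun _ => (0 : ℝ)) (fun _ => M)).toFinset := by
    ext α; rw [mem_cubeF, Set.Finite.mem_toFinset, box₀_eq_cbox]
  have hc1 : (((cubeF K M).filter (fun α => α - α₀ ∈ 𝔮)).card : ℝ) =
      Nat.card {α : 𝓞 K // α ∈ cbox K (fun _ => (0 : ℝ)) (fun _ => M) ∧ α - α₀ ∈ 𝔮} := by
    rw [hcubeF, card_filter_eq_natCard]
  have hc2 : (((innerF K a ε M).filter (fun α => α - α₀ ∈ 𝔮)).card : ℝ) =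
      Nat.card {α : 𝓞 K // α ∈ cbox K (fun _ => Real.exp a * M) (fun _ => Real.exp (-ε) * M) ∧ α - α₀ ∈ 𝔮} := by
    rw [innerF, card_filter_eq_natCard]
  -- `#(layer ∩ coset) = #(cube ∩ coset) − #(inner ∩ coset)`
  have hsub : (innerF K a ε M).filter (fun α => α - α₀ ∈ 𝔮) ⊆ (cubeF K M).filter (fun α => α - α₀ ∈ 𝔮) :=
    Finset.filter_subset_filter _ (innerF_subset_cubeF hε.le hM0.le)
  have hcard : (((cubeF K M \ innerF K a ε M).filter (fun α => α - α₀ ∈ 𝔮)).card : ℝ) =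
      ((cubeF K M).filter (fun α => α - α₀ ∈ 𝔮)).card - ((innerF K a ε M).filter (fun α => α - α₀ ∈ 𝔮)).card := by
    have hfs : (cubeF K M \ innerF K a ε M).filter (fun α => α - α₀ ∈ 𝔮) =
        (cubeF K M).filter (fun α => α - α₀ ∈ 𝔮) \ (innerF K a ε M).filter (fun α => α - α₀ ∈ 𝔮) := by
      ext α
      simp only [Finset.mem_filter, Finset.mem_sdiff]
      tauto
    rw [hfs, Finset.card_sdiff_of_subset hsub, Nat.cast_sub (Finset.card_le_card hsub)]
  rw [hcard, hc1, hc2]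
  -- volumes
  have hvol1 : ∏ _w : RP, (M - 0) = M ^ d := by rw [sub_zero, Finset.prod_const, Finset.card_univ, SmoothCoset.card_RP_eq]
  have hvol2 : ∏ _w : RP, (Real.exp (-ε) * M - Real.exp a * M) = ((Real.exp (-ε) - Real.exp a) * M) ^ d := by
    rw [Finset.prod_const, Finset.card_univ, SmoothCoset.card_RP_eq]; ring
  rw [hvol1] at hcube
  rw [hvol2] at hinner
  have hN := absNorm_pos_of_ne_bot h𝔮
  have hD : 0 < Real.sqrt |(discr K : ℝ)| := Real.sqrt_pos.2 (abs_pos.2 (Int.cast_ne_zero.2 (discr_ne_zero K)))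
  -- `M^d − ((e^{-ε} − e^a) M)^d ≤ d M^d (ε + e^a)`
  have hx0 : 0 ≤ Real.exp (-ε) - Real.exp a := by linarith [Real.exp_le_exp.2 haε]
  have hdiff : M ^ d - ((Real.exp (-ε) - Real.exp a) * M) ^ d ≤ d * M ^ d * (ε + Real.exp a) := by
    rw [mul_pow]
    -- Bernoulli (Mathlib `one_add_mul_sub_le_pow`): `1 − x^d ≤ d (1 − x)` for `x ≥ −1`
    have h1 : 1 - (Real.exp (-ε) - Real.exp a) ^ d ≤ d * (1 - (Real.exp (-ε) - Real.exp a)) := by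
      have := one_add_mul_sub_le_pow (by linarith : (-1 : ℝ) ≤ Real.exp (-ε) - Real.exp a) d
      linarith
    have h2 : 1 - (Real.exp (-ε) - Real.exp a) ≤ ε + Real.exp a := by
      have := Real.add_one_le_exp (-ε); linarith
    have hMd : 0 ≤ M ^ d := by positivity
    have hd0 : (0 : ℝ) ≤ d := Nat.cast_nonneg _
    nlinarith [mul_le_mul_of_nonneg_left h2 hd0]
  -- combine the two absolute-value bounds
  have hE := abs_le.1 hcube
  have hE' := abs_le.1 hinner
  have hkey : (M ^ d / (Ideal.absNorm 𝔮 * √|(discr K : ℝ)|)) - (((Real.exp (-ε) - Real.exp a) * M) ^ d /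
      (Ideal.absNorm 𝔮 * √|(discr K : ℝ)|)) ≤ d * M ^ d * (ε + Real.exp a) / (Ideal.absNorm 𝔮 * √|(discr K : ℝ)|) := by
    rw [← sub_div]; exact div_le_div_of_nonneg_right hdiff (by positivity)
  linarith

/-- **The whole layer** (`𝔮 = 1`): `#Layer ≤ d M^d (ε + e^a)/√|D| + 2 C_G (1 + M^{d−1})`.
[cite: Hinz1988, §1 (1.4)–(1.5)] -/
theorem card_layer_le {CG : ℝ}
    (hCG : ∀ (𝔮 : (Ideal (𝓞 K))⁰) (N : ℝ), 1 ≤ N → ∀ (lo hi : RP → ℝ), (∀ w, lo w ≤ hi w) →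
      (∀ w, hi w - lo w ≤ N) → ∀ α₀ : 𝓞 K,
      |(Nat.card {α : 𝓞 K // α ∈ cbox K lo hi ∧ α - α₀ ∈ (𝔮 : Ideal (𝓞 K))} : ℝ) -
          (∏ w, (hi w - lo w)) / (Ideal.absNorm (𝔮 : Ideal (𝓞 K)) * √|discr K|)| ≤
        CG * (1 + (N ^ d / Ideal.absNorm (𝔮 : Ideal (𝓞 K))) ^ (1 - 1 / (d : ℝ))))
    {M : ℝ} (hM : 1 ≤ M) {a ε : ℝ} (hε : 0 < ε) (haε : a ≤ -ε) :
    ((cubeF K M \ innerF K a ε M).card : ℝ) ≤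
      d * M ^ d * (ε + Real.exp a) / √|discr K| + 2 * CG * (1 + (M ^ d) ^ (1 - 1 / (d : ℝ))) := by
  have h := card_layer_coset_le hCG (𝔮 := ⊤) (bot_ne_top (α := Ideal (𝓞 K))).symm hM hε haε 0
  simp only [sub_zero, Submodule.mem_top, Finset.filter_true_of_mem (fun _ _ => trivial), Ideal.absNorm_top,
    Nat.cast_one, one_mul, div_one] at h
  exact h

/-! ## The boundary terms summed over the moduli -/

omit [IsTotallyReal K] in
/-- `∑_{N𝔮≤Q} (M^d/N𝔮)^{1−1/d} ≤ (M^d)^{1−1/d} Q^{1/d} H(Q)` for `Q ≥ 1` (`N𝔮^{1/d} ≤ Q^{1/d}`).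
[folklore] -/
theorem sum_rpow_quot_le {M Q : ℝ} (hM : 0 < M) (hQ : 1 ≤ Q) :
    ∑ 𝔮 ∈ idealsLE K Q, (M ^ d / Ideal.absNorm 𝔮 : ℝ) ^ (1 - 1 / (d : ℝ)) ≤
      (M ^ d) ^ (1 - 1 / (d : ℝ)) * Q ^ (1 / (d : ℝ)) * ∑ 𝔮 ∈ idealsLE K Q, ((Ideal.absNorm 𝔮 : ℕ) : ℝ)⁻¹ := by
  have hd : 0 < d := Module.finrank_pos
  have hdR : (0 : ℝ) < d := by exact_mod_cast hd
  have hexp0 : 0 ≤ 1 - 1 / (d : ℝ) := by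
    rw [sub_nonneg, div_le_one hdR]; exact_mod_cast hd
  rw [Finset.mul_sum]
  refine Finset.sum_le_sum fun 𝔮 h𝔮 => ?_
  obtain ⟨h0, hle⟩ := mem_idealsLE.1 h𝔮
  have hN := absNorm_pos_of_ne_bot h0
  rw [Real.div_rpow (by positivity) hN.le]
  -- `N^{-(1-1/d)} = N^{1/d} / N ≤ Q^{1/d} / N`
  have hsplit : ((Ideal.absNorm 𝔮 : ℝ)) ^ (1 - 1 / (d : ℝ)) = Ideal.absNorm 𝔮 / (Ideal.absNorm 𝔮 : ℝ) ^ (1 / (d : ℝ)) := by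
    rw [Real.rpow_sub hN, Real.rpow_one]
  rw [hsplit, div_div_eq_mul_div]
  rw [div_le_iff₀ hN]
  have h1 : (Ideal.absNorm 𝔮 : ℝ) ^ (1 / (d : ℝ)) ≤ Q ^ (1 / (d : ℝ)) :=
    Real.rpow_le_rpow hN.le hle (by positivity)
  have hMpos : 0 ≤ (M ^ d) ^ (1 - 1 / (d : ℝ)) := by positivity
  calc (M ^ d) ^ (1 - 1 / (d : ℝ)) * (Ideal.absNorm 𝔮 : ℝ) ^ (1 / (d : ℝ))
      ≤ (M ^ d) ^ (1 - 1 / (d : ℝ)) * Q ^ (1 / (d : ℝ)) := mul_le_mul_of_nonneg_left h1 hMpos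
    _ = (M ^ d) ^ (1 - 1 / (d : ℝ)) * Q ^ (1 / (d : ℝ)) * ((Ideal.absNorm 𝔮 : ℕ) : ℝ)⁻¹ * Ideal.absNorm 𝔮 := by
        field_simp

end Literature.NumberTheory.Sieve.SmoothToSharp
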